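import Summits.Ventures.HodgeRepro2.T5SU11SphericalFunction
import Summits.Ventures.HodgeRepro2.T5SU11CoeffSqCartan

/-!
# `φ_2 ≡ 1`: the spherical function of parameter `2ρ = 2` is identically `1`, i.e. `∫_K e^{2 t(k g)} dk = 1`

The integrand of `sph 2 (a_t) = ∫_K |cosh t - ū² sinh t|^{-2} dk` (`T5SU11SphericalFunction.sph_hyp`) is
the POISSON KERNEL `P(ū² tanh t) = (1 - |z|²)/|1 - z|²` of `T5SU11Horocycle` at the point `z = ū² tanh t`
(`norm_rpow_neg_two_eq_poisson`), and the `K`-average of the Poisson kernel over a circle `|z| = r < 1`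
is `1` (`integral_poisson_haarCircle`): `P = Re ((1 + z)/(1 - z))` is the real part of a holomorphic
function with value `1` at `0`, so the circle mean value of `p2`'s `DiscMeanValue.integral_angle`
gives `∫_{-π}^{π} P(r e^{iθ}) dθ = 2π`, and the `K`-average is that integral after the
reparametrisation `θ ↦ -2θ` and the `2π`-periodicity of `circleMap`. Hence
**`sph 2 (a_t) = 1`** for `t ≥ 0` (`sph_two_hyp`), and by the Cartan decomposition
**`sph 2 g = 1` for every `g`** (`sph_two`): `∫_K e^{2 t(k g)} dk = 1`
(`integral_exp_two_mul_iwasawaT`) — the classical identity `φ_{2ρ} = 1` (the Iwasawa Jacobian `e^{2ρ t}`,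
`2ρ = 2` for `SU(1,1)` where `Δ_B = e^{2t}`, averages to `1` over `K`). Nothing is claimed about (N).

Blind lane: Mathlib + the HodgeRepro2 prefix only (own files + `p2`'s `DiscMeanValue`); no sorry;
axioms ⊆ {propext, Classical.choice, Quot.sound}.
-/

namespace Summit.Ventures.HodgeRepro2.T5SU11SphericalTwo

open MeasureTheory MeasureTheory.Measure Metric Set Complex intervalIntegral
open T5PoincareDensity T5SU11Unimodular T5SU11Fibration T5SU11Cartan T5SU11OneParameter
  T5BergmanCoefficient T5SU11IwasawaProjection T5SU11CartanProjection T5HaarCircle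
  T5SU11SphericalFunction T5SU11Horocycle T5SU11HorocycleTransitive T5SU11CoeffSqCartan
open scoped Real

/-! ### The integrand of `sph 2 (a_t)` is the Poisson kernel -/

/-- **`|cosh t - w sinh t|^{-2} = P(w tanh t)`** for `|w| = 1`: the integrand of `sph 2 (a_t)` is the
Poisson kernel at the point `w tanh t` of the circle of radius `tanh t`. -/
theorem norm_rpow_neg_two_eq_poisson (t : ℝ) {w : ℂ} (hw : ‖w‖ = 1) :
    ‖(Real.cosh t : ℂ) - w * Real.sinh t‖ ^ (-(2 : ℝ)) = poisson (w * Real.tanh t) := by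
  have hc : Real.cosh t ≠ 0 := (Real.cosh_pos t).ne'
  have hcC : (Real.cosh t : ℂ) ≠ 0 := by exact_mod_cast hc
  have hX : (Real.cosh t : ℂ) - w * Real.sinh t ≠ 0 := by
    intro h
    have h1 : (Real.cosh t : ℂ) = w * Real.sinh t := sub_eq_zero.mp h
    have h2 := congrArg norm h1
    rw [norm_mul, hw, one_mul, Complex.norm_real, Complex.norm_real, Real.norm_eq_abs,
      Real.norm_eq_abs, abs_of_pos (Real.cosh_pos t), Real.abs_sinh] at h2
    linarith [Real.sinh_lt_cosh |t|, Real.cosh_abs t]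
  have hXn : 0 < ‖(Real.cosh t : ℂ) - w * Real.sinh t‖ := norm_pos_iff.mpr hX
  rw [Real.rpow_neg hXn.le, Real.rpow_two, poisson, Complex.normSq_eq_norm_sq,
    Complex.normSq_eq_norm_sq, norm_mul, hw, one_mul, Complex.norm_real, Real.norm_eq_abs, sq_abs,
    one_sub_tanh_sq]
  have e : (1 : ℂ) - w * Real.tanh t = ((Real.cosh t : ℂ) - w * Real.sinh t) / Real.cosh t := by
    rw [Real.tanh_eq_sinh_div_cosh, Complex.ofReal_div]
    field_simp
  rw [e, norm_div, Complex.norm_real, Real.norm_eq_abs, abs_of_pos (Real.cosh_pos t), div_pow,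
    inv_pow]
  field_simp

/-! ### The `K`-average of the Poisson kernel is `1` -/

/-- `P(z) = Re ((1 + z)/(1 - z))` on the disc (restated from `T5SU11HorocycleTransitive.half_re`). -/
lemma poisson_eq_re_half {z : ℂ} (hz : z ∈ ball (0 : ℂ) 1) : poisson z = (half z).re :=
  (half_re hz).symm

/-- `half` is holomorphic on every closed disc of radius `R < 1`. -/
lemma diffContOnCl_half {R : ℝ} (hR0 : 0 < R) (hR1 : R < 1) :
    DiffContOnCl ℂ half (ball (0 : ℂ) R) := by
  apply DifferentiableOn.diffContOnCl
  rw [closure_ball (0 : ℂ) hR0.ne']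
  intro z hz
  have hz1 : (1 : ℂ) - z ≠ 0 := by
    intro h
    have h1 : z = 1 := (sub_eq_zero.mp h).symm
    have := mem_closedBall_zero_iff.mp hz
    rw [h1, norm_one] at this
    linarith
  exact ((differentiableAt_const _).add differentiableAt_id).div
    ((differentiableAt_const _).sub differentiableAt_id) hz1 |>.differentiableWithinAt

/-- `θ ↦ half (r e^{iθ})` is continuous for `r < 1`. -/
lemma continuous_half_circleMap {r : ℝ} (hr1 : |r| < 1) :
    Continuous fun θ : ℝ => half (circleMap 0 r θ) := by
  refine continuous_iff_continuousAt.2 fun θ => ?_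
  have hz1 : (1 : ℂ) - circleMap 0 r θ ≠ 0 := by
    intro h
    have h1 : circleMap 0 r θ = 1 := (sub_eq_zero.mp h).symm
    have := norm_circleMap_zero r θ
    rw [h1, norm_one] at this
    linarith
  have hc : ContinuousAt half (circleMap 0 r θ) :=
    ((continuousAt_const.add continuousAt_id).div (continuousAt_const.sub continuousAt_id) hz1)
  exact hc.comp (continuous_circleMap 0 r).continuousAt

/-- `∫_{-π}^{π} P(r e^{iθ}) dθ = 2π` for `0 < r < 1`: the real part of the circle mean value of
`(1 + z)/(1 - z)`. -/
theorem integral_poisson_circleMap {r : ℝ} (hr0 : 0 < r) (hr1 : r < 1) :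
    ∫ θ in Ioo (-π) π, poisson (circleMap 0 r θ) = 2 * π := by
  have hR0 : 0 < (1 + r) / 2 := by linarith
  have hR1 : (1 + r) / 2 < 1 := by linarith
  have hmean := DiscMeanValue.integral_angle (diffContOnCl_half hR0 hR1) hr0 (by linarith)
  have hball : ∀ θ : ℝ, circleMap 0 r θ ∈ ball (0 : ℂ) 1 := by
    intro θ
    rw [mem_ball_zero_iff, norm_circleMap_zero, abs_of_pos hr0]
    exact hr1
  have hint : Integrable (fun θ : ℝ => half (circleMap 0 r θ)) (volume.restrict (Ioo (-π) π)) :=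
    ((continuous_half_circleMap (by rw [abs_of_pos hr0]; exact hr1)).integrableOn_Icc).mono_set
      Ioo_subset_Icc_self
  have h : ∫ θ in Ioo (-π) π, (half (circleMap 0 r θ)).re = ((2 * π) • half 0).re := by
    have := integral_re hint
    simp only [RCLike.re_to_complex] at this
    rw [this, hmean]
  have hh0 : half 0 = 1 := by
    unfold half
    simp
  rw [hh0, Complex.smul_re, Complex.one_re, smul_eq_mul, mul_one] at h
  rw [← h]
  exact setIntegral_congr_fun measurableSet_Ioo fun θ _ => poisson_eq_re_half (hball θ)

/-- `conj (e^{iθ})² · r = circleMap 0 r (-2θ)`. -/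
lemma conj_exp_sq_mul (r θ : ℝ) :
    (starRingEnd ℂ) ((Circle.exp θ : Circle) : ℂ) ^ 2 * (r : ℂ) = circleMap 0 r (-2 * θ) := by
  rw [Circle.coe_exp, ← Complex.exp_conj, map_mul, Complex.conj_ofReal, Complex.conj_I,
    ← Complex.exp_nat_mul, circleMap_zero, mul_comm]
  congr 2
  push_cast
  ring

/-- `θ ↦ P(circleMap 0 r θ)` is `2π`-periodic. -/
lemma periodic_poisson_circleMap (r : ℝ) :
    Function.Periodic (fun θ : ℝ => poisson (circleMap 0 r θ)) (2 * π) := fun θ => by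
  simp only [periodic_circleMap 0 r θ]

/-- `θ ↦ P(circleMap 0 r θ)` is continuous for `|r| < 1`. -/
lemma continuous_poisson_circleMap {r : ℝ} (hr1 : |r| < 1) :
    Continuous fun θ : ℝ => poisson (circleMap 0 r θ) := by
  have hball : ∀ θ : ℝ, circleMap 0 r θ ∈ ball (0 : ℂ) 1 := by
    intro θ
    rw [mem_ball_zero_iff, norm_circleMap_zero]
    exact hr1
  have e : (fun θ : ℝ => poisson (circleMap 0 r θ)) = fun θ => (half (circleMap 0 r θ)).re :=
    funext fun θ => poisson_eq_re_half (hball θ)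
  rw [e]
  exact Complex.continuous_re.comp (continuous_half_circleMap hr1)

/-- **The `K`-average of the Poisson kernel on the circle of radius `r ∈ (0, 1)` is `1`**:
`∫_K P(ū² r) dk = 1`. -/
theorem integral_poisson_haarCircle [MeasurableSpace Circle] [BorelSpace Circle] {r : ℝ}
    (hr0 : 0 < r) (hr1 : r < 1) :
    ∫ u, poisson ((starRingEnd ℂ) (u : ℂ) ^ 2 * r) ∂haarCircle = 1 := by
  rw [integral_haarCircle]
  simp_rw [conj_exp_sq_mul]
  set g : ℝ → ℝ := fun θ => poisson (circleMap 0 r θ) with hg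
  have hper : Function.Periodic g (2 * π) := periodic_poisson_circleMap r
  have hcont : Continuous g := continuous_poisson_circleMap (by rw [abs_of_pos hr0]; exact hr1)
  have hint : ∀ t₁ t₂ : ℝ, IntervalIntegrable g volume t₁ t₂ := fun t₁ t₂ =>
    hcont.intervalIntegrable t₁ t₂
  -- the reparametrisation `θ ↦ -2θ`
  have h1 : ∫ θ in (0 : ℝ)..2 * π, g (-2 * θ) = (-2 : ℝ)⁻¹ • ∫ θ in (-2 : ℝ) * 0..(-2) * (2 * π), g θ :=
    integral_comp_mul_left (fun θ => g θ) (by norm_num)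
  -- over two periods, then over one period shifted to `(-π, π)`
  have h2 : ∫ θ in (-2 : ℝ) * 0..(-2) * (2 * π), g θ = -(2 : ℤ) • ∫ θ in (-4 * π)..(-4 * π + 2 * π), g θ := by
    rw [integral_symm, show (-2 : ℝ) * 0 = -4 * π + (2 : ℤ) • (2 * π) by
      rw [zsmul_eq_mul, Int.cast_ofNat]; ring,
      show (-2 : ℝ) * (2 * π) = -4 * π by ring, hper.intervalIntegral_add_zsmul_eq 2 (-4 * π) hint,
      neg_zsmul]
  have h3 : ∫ θ in (-4 * π)..(-4 * π + 2 * π), g θ = ∫ θ in (-π)..(-π + 2 * π), g θ :=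
    hper.intervalIntegral_add_eq (-4 * π) (-π)
  have h4 : ∫ θ in (-π)..(-π + 2 * π), g θ = 2 * π := by
    rw [show -π + 2 * π = π by ring, integral_of_le (by linarith [Real.pi_pos]),
      integral_Ioc_eq_integral_Ioo]
    exact integral_poisson_circleMap hr0 hr1
  rw [show (fun θ : ℝ => poisson (circleMap 0 r (-2 * θ))) = fun θ => g (-2 * θ) from rfl, h1, h2, h3,
    h4]
  simp only [zsmul_eq_mul, Int.cast_neg, Int.cast_ofNat, smul_eq_mul]
  have hπ : π ≠ 0 := Real.pi_pos.ne'
  field_simp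

/-! ### `φ_2 ≡ 1` -/

section measure

variable [MeasurableSpace Circle] [BorelSpace Circle]

/-- **`sph 2 (a_t) = 1`** for `t ≥ 0`. -/
theorem sph_two_hyp {t : ℝ} (ht : 0 ≤ t) : sph 2 (hyp t) = 1 := by
  rcases ht.eq_or_lt with rfl | ht
  · rw [hyp_zero, sph_one]
  · rw [sph_hyp]
    have hw : ∀ u : Circle, ‖(starRingEnd ℂ) (u : ℂ) ^ 2‖ = 1 := fun u => by
      rw [norm_pow, Complex.norm_conj, Circle.norm_coe, one_pow]
    simp_rw [norm_rpow_neg_two_eq_poisson t (hw _)]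
    have htanh0 : 0 < Real.tanh t := by
      rw [Real.tanh_eq_sinh_div_cosh]
      exact div_pos (Real.sinh_pos_iff.mpr ht) (Real.cosh_pos t)
    exact integral_poisson_haarCircle htanh0 (Real.tanh_lt_one t)

/-- **`φ_2 ≡ 1`**: the spherical function of parameter `2` is identically `1` on `SU(1,1)`. -/
theorem sph_two (g : SU11) : sph 2 g = 1 := by
  rw [sph_eq_sph_hyp_cartanT]
  exact sph_two_hyp (cartanT_nonneg g)

/-- **`∫_K e^{2 t(k g)} dk = 1`** for every `g`: the Iwasawa Jacobian `e^{2ρ t}` averages to `1` over `K`. -/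
theorem integral_exp_two_mul_iwasawaT (g : SU11) :
    ∫ u, Real.exp (2 * iwasawaT (rot u * g)) ∂haarCircle = 1 :=
  sph_two g

end measure

end Summit.Ventures.HodgeRepro2.T5SU11SphericalTwo
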